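import Literature.NumberTheory.PAdicHodge.AinfRamifiedOmegaPeriodNonvanishingOrdinary
import Literature.NumberTheory.PAdicHodge.AinfRamifiedOmegaPeriodNonvanishingVarpi
import HarnessLib

/-!
# (N1‴) over the ramified base at SUPERSINGULAR (height-two) reduction, by ϖ-adic tower descent: `∫_t ω ≠ 0` for every
# Tate-module point `t` of `Ŵ(𝒪_{ℂ_F})` with `t₁ ≠ 0`, for EVERY ramification index `e` — no `e < 2p − 1`, no `e < r + (p − 1)`

Topic `Literature/NumberTheory/PAdicHodge`; namespace `Literature.NumberTheory.PAdicHodge.AinfRamTop`. THEOREMS ONLY (no definition,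
no named fact, no instance, no `sorry`). The SUPERSINGULAR companion of `AinfRamifiedOmegaPeriodNonvanishingOrdinary` ((N1″), height one)
and the inequality-free form of `AinfRamifiedOmegaPeriodNonvanishingVarpi` ((N1′), ϖ-shape).

WHY. (N1′) `omegaPeriod_ne_zero_of_varpi_shape` runs `∫_t ω = 0 ⟹ [t] = 0 ⟹ [p][t⁺] = 0 ⟹ θ_𝒪[t⁺] = 0` through (L2′-θ)
(`AinfRamifiedPTorsionTheta.theta_eq_zero_of_mulP_eq_zero`): a `p`-torsion point `T ∈ Ŵ(𝔫_𝒪)` is divisible by `ϱ`, so `‖θ_𝒪(T)‖ ≤ ‖ϖ‖`,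
and the torsion SEPARATION theorem kills it — which needs the valuation bounds `e < 2p − 1`, `e < r + (p − 1)` (`r` = the `ϱ`-order of
the Hasse coefficient). At the cell `(5; II)` = `(p; e, r₄) = (5; 6, 2)` the second bound fails by equality (`6 = 2 + 4`: the
canonical-subgroup regime, where `Ŵ[p](𝔪_{ℂ_F})` DOES contain points of norm `‖ϖ‖`), and the tree recorded the cell as «still outside»
(`DeRhamSupersingularRamifiedCells`, module docstring). Here the separation step is replaced by the ϖ-ADIC DESCENT ALONG THE WHOLE
DIVISION TOWER of Fontaine elements `T_k = [t⁽ᵏ⁾]` (`[p]T_{k+1} = T_k`, `θ_𝒪(T_k) = t_k`), exactly as in the height-one file, but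
run on the ϖ-shape `[p] = ϱ·X·Q + X^{p²}·S`, `S(0) ≡ −1 (mod ϱ)`:

* §1 (A) `ϖ ∣ [p]a ⟹ ϖ ∣ a` on `𝔫_𝒪` (`[p](a) = ϖ·a·Q(a) + a^{p²}·S(a)` with `S(a)` a unit — tree `coe_mulP_eq_of_varpi_shape`,
  `isUnit_evalAt_of_constantCoeff_add_one_mem` — so `ϖ ∣ a^{p²}`, and `A_inf(𝒪)/ϖ = 𝒪_{ℂ_F}♭` is reduced);
  (B) `ϖᵏ ∣ a`, `k ≥ 1 ⟹ ϖᵏ⁺¹ ∣ [p]a` (`k·p² ≥ k + 1`);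
* §2 the tower lemma `eq_zero_of_mulP_tower_of_varpi_shape`: `[p]T_{k+1} = T_k` on `𝔫_𝒪` for all `k` and `ϖ ∣ T₀` force every `T_k = 0`
  ((A) by induction: `ϖ ∣ T_k`; (B) upgrades `ϖᵃ ∣ T_{k+1}` to `ϖᵃ⁺¹ ∣ T_k`; `⋂ₐ ϖᵃ A_inf(𝒪) = 0`);
* §3 **(N1‴) `omegaPeriod_ne_zero_of_varpi_shape_tower`**: `∫_t ω = 0 ⟹ [t] = 0` (L1′) `⟹ [t⁽ᵏ⁾] = 0 ∀ k ⟹ t₁ = θ_𝒪([t⁽¹⁾]) = 0`; so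
  **`∫_t ω ≠ 0` whenever `t₀ = 0`, `t₁ ≠ 0`, for EVERY `e`** — the hypotheses are the ϖ-shape and `S(0) + 1 ∈ (ϱ)` only;
* §4 consequences with the ϖ-shape DISCHARGED: `omegaPeriod_ne_zero_of_isUnit_Δ_of_hasseCoeff` — any `W` over `𝒪_D = ℤ_p[X]/(X^e − p)`,
  `p ≥ 5`, with `Δ(W) ∈ 𝒪_Dˣ` and supersingular reduction along every `𝒪_D → 𝔽_p` (Serre's shape lemma, tree
  `exists_formalMul_prime_eq_varpi_shape`); `omegaPeriod_model_ne_zero_of_pos` — the cell models `⟨0, 0, 0, a ϱ^{r₄}, b ϱ^{r₆}⟩`,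
  `p ∈ {5, 7}`, `r₄ > 0` (resp. `r₆ > 0`), `3r₄ = e t₄`, `2r₆ = e t₆`, `64a³p^{t₄} + 432b²p^{t₆} ∈ ℤ_pˣ`, for EVERY `e` — in particular the
  new cell `(5; e, r₄, t₄) = (5; 6, 2, 1)` (Kodaira II at `5`); and the Tate-module currency `omegaPeriod_seqO_ne_zero_of_varpi_shape_tower`.

Consumers: the supersingular local formula of the K★ / TDS57 / LOW lines (`…LocalFormulaSupersingularCellsNumerology.localFormula_of_numerology`,
hypotheses `h5`/`h7`), whose `e`-inequalities this file makes removable. BSD is not proved by any of this; K★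
(`stmt-BirchSwinnertonDyer-22226`) and LOW (`stmt-BirchSwinnertonDyer-23884`) stay open.

## References
* [Fontaine1982FormesDifferentielles] J.-M. Fontaine, Invent. Math. 65 (1982), §5 (the period pairing `T_pĜ × ω_G → B_dR⁺`).
* [Tate1967] J. Tate, *p-divisible groups* (1967), §4.
* [SilvermanAEC2009] J. H. Silverman, *AEC* (2009), IV.4.4, IV.7.5.
* [Serre1967GroupesPDivisibles] J.-P. Serre, Sém. Bourbaki 318, §5 Lemme 3 (the shape of `[p]` at height two).
* [FarguesFontaine2018] L. Fargues, J.-M. Fontaine, Astérisque 406 (2018), §1.2, §2.2 (`A_inf/p = 𝒪♭` perfect, reduced).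
* [FontaineAsterisque223III] J.-M. Fontaine, Astérisque 223 (1994), Exp. II §1.2–§1.3.
-/

noncomputable section

open Ideal Field ValuativeRel

namespace Literature.NumberTheory.PAdicHodge

open Literature.NumberTheory.GaloisRepresentations
open Literature.NumberTheory.GaloisRepresentations.IsNonarchimedeanLocalField
open Literature.NumberTheory.GaloisRepresentations.LubinTate
open Literature.NumberTheory.EllipticCurves

namespace AinfRamTop

variable {F : Type} [Field F] [ValuativeRel F] [TopologicalSpace F] [IsNonarchimedeanLocalField F] [CharZero F]
  {p : ℕ} [Fact p.Prime] [Fact (¬ IsUnit (p : integerC F))] [IsAdicComplete (Ideal.span {(p : integerC F)}) (integerC F)]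
  {hp : valuation F p < 1} {D : EisensteinRoot F p hp}
  {hθ : Function.Surjective (WittVector.fontaineTheta (integerC F) p)}
  (W : WeierstrassCurve (EisensteinRoot.CoeffDisc D))

/-! ## §1 (A) and (B) under the ϖ-shape -/

/-- **(A) `ϖ ∣ [p]a ⟹ ϖ ∣ a` on `𝔫_𝒪` at height two.** With the ϖ-shape `[p](a) = ϖ·a·Q(a) + a^{p²}·S(a)` and `S(a)` a unit
(`S(0) ≡ −1 (mod ϱ)`): `ϖ ∣ a^{p²}·S(a)`, so `ϖ ∣ a^{p²}`, so `ϖ ∣ a` (`A_inf(𝒪)/ϖ = 𝒪_{ℂ_F}♭` is reduced).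
[cite: Serre1967GroupesPDivisibles, §5 Lemme 3] [cite: FarguesFontaine2018, §1.2 and §2.2] -/
theorem of_varpi_dvd_of_dvd_mulP_of_varpi_shape {Q S : PowerSeries (EisensteinRoot.CoeffDisc D)}
    (hshape : W.formalMul p = PowerSeries.C (EisensteinRoot.CoeffDisc.of D (AdjoinRoot.root D.poly)) * PowerSeries.X * Q +
      PowerSeries.X ^ (p ^ 2) * S)
    (hS : PowerSeries.constantCoeff S + 1 ∈ Ideal.span {EisensteinRoot.CoeffDisc.of D (AdjoinRoot.root D.poly)})
    (a : (nilTheta D hθ).toIdeal) (h : of D (AinfRam.varpi D) ∣ (mulP W a : AinfRamTop D)) :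
    of D (AinfRam.varpi D) ∣ (a : AinfRamTop D) := by
  obtain ⟨u, hu⟩ := isUnit_evalAt_of_constantCoeff_add_one_mem (D := D) (hθ := hθ) a hS
  rw [coe_mulP_eq_of_varpi_shape W hshape a] at h
  have h1 : of D (AinfRam.varpi D) ∣ of D (AinfRam.varpi D) * a * evalAt (nilTheta D hθ) a Q :=
    ⟨(a : AinfRamTop D) * evalAt (nilTheta D hθ) a Q, by ring⟩
  have h2 : of D (AinfRam.varpi D) ∣ (a : AinfRamTop D) ^ (p ^ 2) * evalAt (nilTheta D hθ) a S := (dvd_add_right h1).1 h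
  rw [← hu] at h2
  exact of_varpi_dvd_of_dvd_pow (((Units.isUnit u).dvd_mul_right).1 h2)

/-- **(B) `ϖᵏ ∣ a`, `1 ≤ k ⟹ ϖᵏ⁺¹ ∣ [p]a` on `𝔫_𝒪`** under the ϖ-shape `[p](a) = ϖ·a·Q(a) + a^{p²}·S(a)` (`k·p² ≥ k + 1`).
[cite: Serre1967GroupesPDivisibles, §5 Lemme 3] [cite: SilvermanAEC2009, IV.7.5] -/
theorem of_varpi_pow_succ_dvd_mulP_of_varpi_shape {Q S : PowerSeries (EisensteinRoot.CoeffDisc D)}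
    (hshape : W.formalMul p = PowerSeries.C (EisensteinRoot.CoeffDisc.of D (AdjoinRoot.root D.poly)) * PowerSeries.X * Q +
      PowerSeries.X ^ (p ^ 2) * S)
    (a : (nilTheta D hθ).toIdeal) {k : ℕ} (hk : 1 ≤ k) (h : of D (AinfRam.varpi D) ^ k ∣ (a : AinfRamTop D)) :
    of D (AinfRam.varpi D) ^ (k + 1) ∣ (mulP W a : AinfRamTop D) := by
  rw [coe_mulP_eq_of_varpi_shape W hshape a]
  refine dvd_add ?_ ?_
  · rw [pow_succ']
    exact (mul_dvd_mul_left (of D (AinfRam.varpi D)) h).mul_right _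
  · have hp2 : 2 ≤ p := (Fact.out : p.Prime).two_le
    have h1 : of D (AinfRam.varpi D) ^ (k + 1) ∣ (a : AinfRamTop D) ^ (p ^ 2) := by
      have h2 : of D (AinfRam.varpi D) ^ (k * p ^ 2) ∣ (a : AinfRamTop D) ^ (p ^ 2) := by
        rw [pow_mul]; exact pow_dvd_pow_of_dvd h (p ^ 2)
      have h4 : 4 ≤ p ^ 2 := by nlinarith
      exact (pow_dvd_pow _ (by nlinarith)).trans h2
    exact h1.mul_right _

/-! ## §2 The tower lemma at height two -/

/-- **The tower lemma under the ϖ-shape.** If `T : ℕ → 𝔫_𝒪` satisfies `[p]T_{k+1} = T_k` for all `k` and `ϖ ∣ T₀`, then **`T_k = 0` for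
every `k`**: (A) gives `ϖ ∣ T_k` for all `k` by induction, (B) upgrades `ϖᵃ ∣ T_{k+1}` to `ϖᵃ⁺¹ ∣ T_k`, so `ϖᵃ ∣ T_k` for all `a, k`, and
`⋂ₐ ϖᵃA_inf(𝒪) = 0`. [cite: Serre1967GroupesPDivisibles, §5 Lemme 3] [cite: FarguesFontaine2018, §1.2 and §2.2] -/
theorem eq_zero_of_mulP_tower_of_varpi_shape {Q S : PowerSeries (EisensteinRoot.CoeffDisc D)}
    (hshape : W.formalMul p = PowerSeries.C (EisensteinRoot.CoeffDisc.of D (AdjoinRoot.root D.poly)) * PowerSeries.X * Q +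
      PowerSeries.X ^ (p ^ 2) * S)
    (hS : PowerSeries.constantCoeff S + 1 ∈ Ideal.span {EisensteinRoot.CoeffDisc.of D (AdjoinRoot.root D.poly)})
    (T : ℕ → (nilTheta D hθ).toIdeal) (hT : ∀ k, (mulP W (T (k + 1)) : AinfRamTop D) = T k)
    (h0 : of D (AinfRam.varpi D) ∣ (T 0 : AinfRamTop D)) (k : ℕ) : (T k : AinfRamTop D) = 0 := by
  -- (A): `ϖ ∣ T k` for all `k`
  have hA : ∀ k, of D (AinfRam.varpi D) ∣ (T k : AinfRamTop D) := by
    intro k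
    induction k with
    | zero => exact h0
    | succ k ih => exact of_varpi_dvd_of_dvd_mulP_of_varpi_shape W hshape hS (T (k + 1)) (by rw [hT k]; exact ih)
  -- (B): `ϖ^(a+1) ∣ T k` for all `a`, `k`
  have hB : ∀ a k : ℕ, of D (AinfRam.varpi D) ^ (a + 1) ∣ (T k : AinfRamTop D) := by
    intro a
    induction a with
    | zero => intro k; rw [zero_add, pow_one]; exact hA k
    | succ a ih =>
      intro k; rw [← hT k]
      exact of_varpi_pow_succ_dvd_mulP_of_varpi_shape W hshape (T (k + 1)) (Nat.succ_le_succ (Nat.zero_le a)) (ih (k + 1))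
  refine eq_zero_of_forall_of_varpi_pow_dvd fun a => ?_
  rcases a with _ | a
  · rw [pow_zero]; exact one_dvd _
  · exact hB a k

/-! ## §3 (N1‴): `∫_t ω ≠ 0` when `t₁ ≠ 0`, at height two, every `e` -/

/-- **(N1‴) over the ramified base under the ϖ-shape, EVERY ramification index.** For `W` over `𝒪_D` with `[p] = ϱ·X·Q + X^{p²}·S`,
`S(0) + 1 ∈ (ϱ)`, and every `[p]`-compatible sequence `t` of points of `Ŵ(𝔪_{ℂ_F})` with `t₀ = 0` and `t₁ ≠ 0`:
**`∫_t ω = log_W(ι_𝒪[t]) ≠ 0` in `B_dR⁺`.** Proof: `∫_t ω = 0 ⟹ [t] = 0` (L1′) `⟹ [t⁽ᵏ⁾] = 0` for all `k` (tower lemma with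
`[p][t⁽ᵏ⁺¹⁾] = [t⁽ᵏ⁾]`) `⟹ t₁ = θ_𝒪([t⁽¹⁾]) = 0`. No bound on `e` (contrast `omegaPeriod_ne_zero_of_varpi_shape`: `e < 2p − 1`,
`e < r + (p − 1)`). [cite: Fontaine1982FormesDifferentielles, §5] [cite: Tate1967, §4] [cite: Serre1967GroupesPDivisibles, §5 Lemme 3] -/
theorem omegaPeriod_ne_zero_of_varpi_shape_tower {Q S : PowerSeries (EisensteinRoot.CoeffDisc D)}
    (hshape : W.formalMul p = PowerSeries.C (EisensteinRoot.CoeffDisc.of D (AdjoinRoot.root D.poly)) * PowerSeries.X * Q +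
      PowerSeries.X ^ (p ^ 2) * S)
    (hS : PowerSeries.constantCoeff S + 1 ∈ Ideal.span {EisensteinRoot.CoeffDisc.of D (AdjoinRoot.root D.poly)})
    {t : ℕ → (maxNilIdealC F).toIdeal} (ht0 : (t 0 : CBall F) = 0) (htp : ∀ n, mulPC W (t (n + 1)) = t n)
    (h1 : (t 1 : CBall F) ≠ 0) : omegaPeriod W hθ t ht0 htp ≠ 0 := by
  intro h
  have hL1 : torsionLift W hθ t htp = 0 := torsionLift_eq_zero_of_omegaPeriod_eq_zero W ht0 htp h
  -- the tower of Fontaine elements of the shifted sequences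
  have hzero := eq_zero_of_mulP_tower_of_varpi_shape (hθ := hθ) W hshape hS
    (fun k => ⟨torsionLift W hθ (fun n => t (n + k)) (mulPC_shift_add W htp k), flim_mem_nilTheta _ _⟩)
    (fun k => mulP_torsionLift_shift_add W htp k)
    (by
      have h0 : torsionLift W hθ (fun n => t (n + 0)) (mulPC_shift_add W htp 0) = 0 :=
        (torsionLift_congr W (t := fun n => t (n + 0)) (t' := t) (fun n => congrArg t (Nat.add_zero n)) (mulPC_shift_add W htp 0) htp).trans hL1
      change of D (AinfRam.varpi D) ∣ torsionLift W hθ (fun n => t (n + 0)) (mulPC_shift_add W htp 0)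
      rw [h0]; exact dvd_zero _)
    1
  have hθ1 : theta D (torsionLift W hθ (fun n => t (n + 1)) (mulPC_shift_add W htp 1)) = t (0 + 1) :=
    theta_torsionLift_eq W (hθ := hθ) (t := fun n => t (n + 1)) (mulPC_shift_add W htp 1)
  change torsionLift W hθ (fun n => t (n + 1)) (mulPC_shift_add W htp 1) = 0 at hzero
  rw [hzero, map_zero, zero_add] at hθ1
  exact h1 hθ1.symm

/-! ## §4 Consequences with the ϖ-shape discharged -/

/-- **(N1‴) for every good supersingular `𝒪_D`-model, every `e`, `p ≥ 5`.** Let `D = (X^e − p, ϖ)` and `W₀` a Weierstrass equation over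
`𝒪_D = ℤ_p[X]/(X^e − p)` with `Δ(W₀) ∈ 𝒪_Dˣ` whose reductions along every `𝒪_D → 𝔽_p` are supersingular (Hasse coefficient `0`). Then
for every `[p]`-compatible sequence `t` of points of `Ŵ₀(𝔪_{ℂ_F})` (equation read in `CoeffDisc D`) with `t₀ = 0`, `t₁ ≠ 0`:
**`∫_t ω ≠ 0`** — Serre's shape lemma (tree `exists_formalMul_prime_eq_varpi_shape`) + (N1‴).
[cite: Serre1967GroupesPDivisibles, §5 Lemme 3] [cite: Fontaine1982FormesDifferentielles, §5] [cite: SilvermanAEC2009, IV.7.5] -/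
theorem omegaPeriod_ne_zero_of_isUnit_Δ_of_hasseCoeff {e : ℕ} (hD : D.poly = Polynomial.X ^ e - Polynomial.C (p : ℤ_[p]))
    (hp5 : 5 ≤ p) (W₀ : WeierstrassCurve D.Coeff) (hΔ : IsUnit W₀.Δ) (hA : ∀ γ : D.Coeff →+* ZMod p, (W₀.map γ).hasseCoeff p = 0)
    {t : ℕ → (maxNilIdealC F).toIdeal} (ht0 : (t 0 : CBall F) = 0)
    (htp : ∀ n, mulPC (W₀.map (EisensteinRoot.CoeffDisc.of D).toRingHom) (t (n + 1)) = t n) (h1 : (t 1 : CBall F) ≠ 0) :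
    omegaPeriod (W₀.map (EisensteinRoot.CoeffDisc.of D).toRingHom) hθ t ht0 htp ≠ 0 := by
  obtain ⟨Q, S, hshape, -, hS⟩ := exists_formalMul_prime_eq_varpi_shape W₀ hD hp5 hΔ hA
  obtain ⟨hshape', hS'⟩ := varpi_shape_map_coeffDisc (p := p) W₀ hshape hS
  exact omegaPeriod_ne_zero_of_varpi_shape_tower _ hshape' hS' ht0 htp h1

/-- **(N1‴) on the cell models, EVERY `e`.** For the model `⟨0, 0, 0, a ϱ^{r₄}, b ϱ^{r₆}⟩` over `𝒪_D = ℤ_p[X]/(X^e − p)`, `p ∈ {5, 7}`, with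
`r₄ > 0` if `p = 5`, `r₆ > 0` if `p = 7` (supersingular reduction), `3r₄ = e t₄`, `2r₆ = e t₆`, `64a³p^{t₄} + 432b²p^{t₆} ∈ ℤ_pˣ` (good
reduction): `∫_t ω ≠ 0` for every `[p]`-compatible `t` with `t₀ = 0`, `t₁ ≠ 0`. VERBATIM `omegaPeriod_model_five/seven_ne_zero_of_lt` of
`DeRhamSupersingularRamifiedCells` WITHOUT the hypotheses `e < 9`, `e < r₄ + 4` (resp. `e < 13`, `e < r₆ + 6`); new cell covered:
`(5; e, r₄, t₄) = (5; 6, 2, 1)` (Kodaira II at `5`). [cite: Serre1967GroupesPDivisibles, §5 Lemme 3] [cite: Fontaine1982FormesDifferentielles, §5]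
[cite: SilvermanAEC2009, IV.7.5] -/
theorem omegaPeriod_model_ne_zero_of_pos {e : ℕ} (hD : D.poly = Polynomial.X ^ e - Polynomial.C (p : ℤ_[p]))
    (hp57 : p = 5 ∨ p = 7) (a b : ℤ_[p]) {r₄ r₆ t₄ t₆ : ℕ} (hr₄ : p = 5 → 0 < r₄) (hr₆ : p = 7 → 0 < r₆)
    (h₄ : 3 * r₄ = e * t₄) (h₆ : 2 * r₆ = e * t₆)
    (hu : IsUnit (64 * a ^ 3 * (p : ℤ_[p]) ^ t₄ + 432 * b ^ 2 * (p : ℤ_[p]) ^ t₆))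
    {t : ℕ → (maxNilIdealC F).toIdeal} (ht0 : (t 0 : CBall F) = 0)
    (htp : ∀ n, mulPC (((⟨0, 0, 0, AdjoinRoot.of D.poly a * AdjoinRoot.root D.poly ^ r₄,
      AdjoinRoot.of D.poly b * AdjoinRoot.root D.poly ^ r₆⟩ : WeierstrassCurve D.Coeff).map
      (EisensteinRoot.CoeffDisc.of D).toRingHom)) (t (n + 1)) = t n)
    (h1 : (t 1 : CBall F) ≠ 0) :
    omegaPeriod (((⟨0, 0, 0, AdjoinRoot.of D.poly a * AdjoinRoot.root D.poly ^ r₄,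
      AdjoinRoot.of D.poly b * AdjoinRoot.root D.poly ^ r₆⟩ : WeierstrassCurve D.Coeff).map
      (EisensteinRoot.CoeffDisc.of D).toRingHom)) hθ t ht0 htp ≠ 0 := by
  obtain ⟨Q, S, hshape, -, hS⟩ := formalMul_prime_varpi_shape_model (D := D) hD hp57 a b h₄ h₆ hu hr₄ hr₆
  obtain ⟨hshape', hS'⟩ := varpi_shape_map_coeffDisc (p := p) _ hshape hS
  exact omegaPeriod_ne_zero_of_varpi_shape_tower _ hshape' hS' ht0 htp h1

variable (ψ : EisensteinRoot.CoeffDisc D →+* LTCoeff F) (hψ : ∀ c, algebraMap (LTCoeff F) F (ψ c) = EisensteinRoot.CoeffDisc.toF D c)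

include hψ in
/-- **(N1‴) in the Tate-module currency**: for `W` over `𝒪_D` with the ϖ-shape of `[p]` (`S(0) ≡ −1 (mod ϱ)`) and `τ ∈ T_pŴ♭(𝒪_{ℂ_F})`
(`W♭ = W ⊗_ψ 𝒪_F`) with `τ₁ ≠ 0`: **`∫_τ ω ≠ 0`** for the coordinate sequence `seqO τ`, every `e`.
[cite: Fontaine1982FormesDifferentielles, §5] [cite: Tate1967, §4] -/
theorem omegaPeriod_seqO_ne_zero_of_varpi_shape_tower {Q S : PowerSeries (EisensteinRoot.CoeffDisc D)}
    (hshape : W.formalMul p = PowerSeries.C (EisensteinRoot.CoeffDisc.of D (AdjoinRoot.root D.poly)) * PowerSeries.X * Q +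
      PowerSeries.X ^ (p ^ 2) * S)
    (hS : PowerSeries.constantCoeff S + 1 ∈ Ideal.span {EisensteinRoot.CoeffDisc.of D (AdjoinRoot.root D.poly)})
    (τ : AinfTop.TatePtO F (W.map ψ) p) (h1 : TateModule.proj p 1 τ ≠ 0) :
    omegaPeriod W hθ (AinfTop.seqO (W.map ψ) τ) (AinfTop.seqO_zero (W.map ψ) τ) (mulPC_seqO W ψ hψ τ) ≠ 0 :=
  omegaPeriod_ne_zero_of_varpi_shape_tower W hshape hS _ _ fun h => h1 (WeierstrassCurve.Pt.ext (Subtype.ext (by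
    rw [AinfTop.seqO_apply] at h
    rw [h, WeierstrassCurve.Pt.val_zero, ZeroMemClass.coe_zero])))

include hψ in
/-- **(N1‴) for a generator of a `ℤ_p`-monogenic `T_pŴ♭ = ℤ_p·v₀`** under the ϖ-shape: **`∫_{v₀} ω ≠ 0`** (`proj₁ v₀ ≠ 0` by
`TateModule.proj_one_ne_zero_of_generator`). [cite: Fontaine1982FormesDifferentielles, §5] [cite: Tate1967, §4] -/
theorem omegaPeriod_seqO_ne_zero_of_generator_of_varpi_shape {Q S : PowerSeries (EisensteinRoot.CoeffDisc D)}
    (hshape : W.formalMul p = PowerSeries.C (EisensteinRoot.CoeffDisc.of D (AdjoinRoot.root D.poly)) * PowerSeries.X * Q +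
      PowerSeries.X ^ (p ^ 2) * S)
    (hS : PowerSeries.constantCoeff S + 1 ∈ Ideal.span {EisensteinRoot.CoeffDisc.of D (AdjoinRoot.root D.poly)})
    {v₀ : AinfTop.TatePtO F (W.map ψ) p} (hv₀ : v₀ ≠ 0) (hgen : ∀ τ : AinfTop.TatePtO F (W.map ψ) p, ∃ c : ℤ_[p], τ = c • v₀) :
    omegaPeriod W hθ (AinfTop.seqO (W.map ψ) v₀) (AinfTop.seqO_zero (W.map ψ) v₀) (mulPC_seqO W ψ hψ v₀) ≠ 0 :=
  omegaPeriod_seqO_ne_zero_of_varpi_shape_tower W ψ hψ hshape hS v₀ (TateModule.proj_one_ne_zero_of_generator hv₀ hgen)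

end AinfRamTop

end Literature.NumberTheory.PAdicHodge

end
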